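import Summits.FinalStateConjecture.FinalStateConjecture.Theorems.PhotonSphereChannelsTameCensorshipFutureCauchyDomain
import Summits.FinalStateConjecture.FinalStateConjecture.Theorems.PhotonSphereChannelsTameCensorshipSpacelikeLens
import Summits.FinalStateConjecture.FinalStateConjecture.Theorems.PhotonSphereChannelsTameCensorshipOpensTransport
import Literature.Geometry.Lorentzian.HawkingCrushBound
import Literature.Geometry.Lorentzian.CausalCurveEndpoint
import Literature.Geometry.Lorentzian.CauchyHypersurfaceGlobalHyperbolicity
import HarnessLib

/-!
# Crux `TameCensorship` (stmt-FinalStateConjecture-10047), line `crush-the-swallowed-interior`: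
# fact-stub F1 `stub_factFutureCauchyCrushBound` — Hawking's length bound for a uniformly
# contracting FUTURE CAUCHY hypersurface, from Wald's Cauchy form

The registered fact-stub `stub_factFutureCauchyCrushBound` of the skeleton
`Cruxes/TameCensorship/Lines/crush_the_swallowed_interior.lean` (lead c1): **if Hawking's crush
bound holds in Wald's Cauchy form (`Literature.Geometry.Lorentzian.HawkingCrushBound`, Wald 1984,
Thm. 9.5.1, time reversed), then it holds for every closed achronal smooth spacelike immersed
hypersurface `S = f(N)` which is future Cauchy (`J⁺(S) ⊆ D⁺(S)`: every past-endless causal curve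
through a point of `J⁺(S)` meets `S`) in any spacetime with the timelike convergence condition:
`H ≤ -C < 0` on `N` gives `d(f y, q) ≤ 3/C` for all `y`, `q`** — O'Neill 1983, Ch. 14,
Thm. 14.55A with Ex. 14.9, reduced to the Cauchy case.

Proof (`stub_factFutureCauchyCrushBound`). For `q ∉ J⁺(f y)` the separation vanishes. Otherwise
let `W = I⁺(S) ∪ S ∪ (I⁺(T) ∩ I⁻(S))` be the region of
`…TameCensorshipFutureCauchyDomain` (lenses at the points of `S` by
`exists_lens_of_isSpacelikeImmersion`; endpoint properties of timelike curves by
`CausalCurveEndpoint`): it is open, contains `J⁺(S)`, and `S` is a Cauchy hypersurface of each of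
its components. The component `W₀ ∋ f y` is a connected open sub-spacetime `𝓢' = (W₀, g|, τ|)`
(`Spacetime.restrict`), globally hyperbolic (`IsCauchyHypersurface.isGloballyHyperbolic`), with
the timelike convergence condition (`satisfiesTimelikeConvergence_restrict`); the piece
`f₀ : f⁻¹(W₀) → W₀` of `f` is a smooth spacelike immersion with the same future unit normal and
mean curvature (`…OpensTransport`, `HypersurfaceRestriction`) whose range `S ∩ W₀` is a Cauchy
hypersurface of `𝓢'`. Hawking's bound in `𝓢'` gives `d_{𝓢'}(f y, q) ≤ 3/C`, and
`d_𝓢(f y, q) ≤ d_{𝓢'}(f y, q)` because every future causal curve from `f y` stays in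
`J⁺(f y) ⊆ W₀` (`lorentzDist_le_lorentzDist_restrict`).

## References

* B. O'Neill, *Semi-Riemannian geometry with applications to relativity*, Academic Press 1983,
  Ch. 14, Ex. 14.9, Thm. 14.38, Lemma 14.43, Thm. 14.44, Thm. 14.55A (pp. 421–432).
  [ONeillSemiRiemannian1983]
* R. M. Wald, *General Relativity*, Chicago 1984, Thm. 9.5.1 (p. 237). [Wald1984GR]
* S. W. Hawking, G. F. R. Ellis, *The large scale structure of space-time*, CUP 1973, §8.2,
  Thm. 4; §6.5–6.6. [HawkingEllis1973CUP]
-/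

noncomputable section

-- The tree namespace `Summit.FinalStateConjecture.FinalStateConjecture.…` (summit = sub-problem)
-- repeats a component by design (D-0022), which the `dupNamespace` linter would flag on every decl.
set_option linter.dupNamespace false

open scoped Manifold ContDiff Topology
open Set Filter Bundle Function TopologicalSpace
open Literature.Geometry.Lorentzian

namespace Summit.FinalStateConjecture.FinalStateConjecture.Theorems.PhotonSphereChannels.TameCensorshipCrush

set_option maxHeartbeats 400000 in
/-- **FACT-STUB F1 — Hawking's length bound for a uniformly contracting FUTURE-CAUCHY
hypersurface, from Wald's Cauchy form** (the registered `stub_factFutureCauchyCrushBound` of the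
line `crush-the-swallowed-interior` of crux `TameCensorship`, stmt-FinalStateConjecture-10047):
assuming `HawkingCrushBound` (Wald 1984, Thm. 9.5.1, time reversed), in a spacetime with the
timelike convergence condition a closed achronal smooth spacelike immersed hypersurface
`S = f(N)` with `J⁺(S) ⊆ D⁺(S)` and mean curvature `H ≤ -C < 0` satisfies `d(f y, q) ≤ 3/C` for
every `y ∈ N` and every event `q`. O'Neill 1983, Ch. 14, Thm. 14.55A (see the module docstring for
the reduction through the globally hyperbolic component `W₀` of the region of
`…TameCensorshipFutureCauchyDomain`).
[cite: ONeillSemiRiemannian1983, Ch. 14, Thm. 14.55A (pp. 431–432)] [cite: Wald1984GR, Theorem 9.5.1 (p. 237)] -/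
theorem stub_factFutureCauchyCrushBound : HawkingCrushBound.{0} →
    ∀ (𝓢 : Spacetime.{0} 4) [𝓢.metric.HasLeviCivita],
      𝓢.metric.SatisfiesTimelikeConvergence →
      ∀ (N : Type) [TopologicalSpace N] [ChartedSpace E3 N] [IsManifold (𝓡 3) ∞ N]
        (f : N → 𝓢.carrier)
        (hpb : PseudoRiemannianMetric.contMDiff_pullbackBilin (𝓡 4) 𝓢.carrier (𝓡 3) N ∞)
        (hf : 𝓢.metric.IsSpacelikeImmersion (𝓡 3) f) (ν : NormalField (𝓡 4) f),
        ContMDiff (𝓡 3) (𝓡 4).tangent ∞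
          (fun y ↦ (TotalSpace.mk' E4 (f y) (ν y) : TangentBundle (𝓡 4) 𝓢.carrier)) →
        𝓢.metric.IsFutureUnitNormal (𝓡 3) 𝓢.timeOrientation f ν →
        IsClosed (Set.range f) → 𝓢.metric.IsAchronal 𝓢.timeOrientation (Set.range f) →
        𝓢.metric.causalFuture 𝓢.timeOrientation (Set.range f) ⊆
          {p : 𝓢.carrier | ∀ (β : ℝ → 𝓢.carrier) (s : Set ℝ), s.OrdConnected →
            𝓢.metric.IsFutureCausalCurveOn 𝓢.timeOrientation β s → IsPastEndless β s →
            ∀ t₀ ∈ s, β t₀ = p → ∃ t ∈ s, t ≤ t₀ ∧ β t ∈ Set.range f} →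
        ∀ C : ℝ, 0 < C → (∀ y, 𝓢.metric.meanCurvature f hpb hf ν y ≤ -C) →
        ∀ (y : N) (q : 𝓢.carrier), 𝓢.lorentzDist (f y) q ≤ ENNReal.ofReal (3 / C) := by
  intro hH 𝓢 _ htc N _ _ _ f hpb hf ν hν hfun hSc hA hFC C hC hHle y q
  classical
  -- the spacetime data
  set g := 𝓢.metric with hg
  set τ := 𝓢.timeOrientation with hτ_def
  set S : Set 𝓢.carrier := Set.range f with hS
  have hres : PseudoRiemannianMetric.contMDiff_restrict (I := 𝓡 4) (n := (∞ : ℕ∞ω))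
      (M := 𝓢.carrier) := PseudoRiemannianMetric.contMDiff_restrict_holds
  have hτr : τ.contMDiff_restrict := τ.contMDiff_restrict_holds
  haveI hcd : CovariantDerivative.ContMDiffCovariantDerivative g.leviCivita 1 :=
    ⟨g.isLocallyContMDiff_leviCivita_holds 1 (by exact_mod_cast le_top) univ isOpen_univ⟩
  have hn2 : (2 : ℕ∞ω) ≤ ∞ := WithTop.coe_le_coe.mpr le_top
  -- (0) off `J⁺(f y)` the separation vanishes
  by_cases hq : q ∈ g.causalFuture τ {f y}
  swap
  · show g.lorentzDist τ (f y) q ≤ _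
    rw [LorentzianMetric.lorentzDist_eq_zero_of_not_mem_causalFuture hq]
    exact zero_le
  -- (1) lenses at the points of `S`
  have hL : ∀ p ∈ S, ∃ V : Opens 𝓢.carrier, p ∈ V ∧
      (g.restrict hres V).IsCauchyHypersurface (τ.restrict hres hτr V) (Subtype.val ⁻¹' S) := by
    rintro p ⟨z, rfl⟩
    exact exists_lens_of_isSpacelikeImmersion 𝓢 hf hν hfun hA z
  -- (2) the region `W`
  set T : Set 𝓢.carrier := {x | ∀ z ∈ g.chronologicalFuture τ {x}, z ∈ g.chronologicalPast τ S →
    ∀ (δ : ℝ → 𝓢.carrier) (s : Set ℝ), s.OrdConnected → g.IsFutureTimelikeCurveOn τ δ s →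
      IsFutureEndless δ s → ∀ t₀ ∈ s, δ t₀ = z → ∃ t ∈ s, t₀ ≤ t ∧ δ t ∈ S} with hT
  set W : Set 𝓢.carrier := g.chronologicalFuture τ S ∪ S ∪
    (g.chronologicalFuture τ T ∩ g.chronologicalPast τ S) with hW
  have hWo : IsOpen W := isOpen_domain hres hτr hT hW hn2 hA hL
  have hJW : g.causalFuture τ S ⊆ W := causalFuture_subset_domain hres hτr hW hn2 hSc hA hL
  have hE : ∀ {c : ℝ → 𝓢.carrier} {s : Set ℝ} {e : 𝓢.carrier} {t t' : ℝ}, s.OrdConnected →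
      g.IsFutureTimelikeCurveOn τ c s → HasPastEndpoint c s e → t ∈ s → t' ∈ s → t < t' →
      c t' ∈ g.chronologicalFuture τ {e} :=
    fun hs hc he ht ht' htt' ↦
      LorentzianMetric.mem_chronologicalFuture_of_hasPastEndpoint τ le_rfl hs hc he ht ht' htt'
  have hE' : ∀ {c : ℝ → 𝓢.carrier} {s : Set ℝ} {e : 𝓢.carrier} {t t' : ℝ}, s.OrdConnected →
      g.IsFutureTimelikeCurveOn τ c s → HasFutureEndpoint c s e → t ∈ s → t' ∈ s → t < t' →
      c t ∈ g.chronologicalPast τ {e} :=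
    fun hs hc he ht ht' htt' ↦
      LorentzianMetric.mem_chronologicalPast_of_hasFutureEndpoint τ le_rfl hs hc he ht ht' htt'
  -- (3) the component `W₀` of `f y`
  have hyS : f y ∈ S := ⟨y, rfl⟩
  have hyW : f y ∈ W := hJW (LorentzianMetric.subset_causalFuture g τ S hyS)
  haveI : LocallyConnectedSpace 𝓢.carrier := ChartedSpace.locallyConnectedSpace E4 𝓢.carrier
  set W₀ : Set 𝓢.carrier := connectedComponentIn W (f y) with hW₀
  have hW₀o : IsOpen W₀ := hWo.connectedComponentIn
  have hW₀W : W₀ ⊆ W := connectedComponentIn_subset _ _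
  have hyW₀ : f y ∈ W₀ := mem_connectedComponentIn hyW
  have hW₀conn : IsConnected W₀ := ⟨⟨f y, hyW₀⟩, isPreconnected_connectedComponentIn⟩
  have hW₀cl : closure W₀ ∩ W ⊆ W₀ := by
    rintro x ⟨hxcl, hxW⟩
    obtain ⟨O, hOW, hOo, hxO, hOc⟩ :=
      (locallyConnectedSpace_iff_subsets_isOpen_isConnected.1 inferInstance) x W (hWo.mem_nhds hxW)
    obtain ⟨z, hzO, hzW₀⟩ : (O ∩ W₀).Nonempty := mem_closure_iff_nhds.1 hxcl O (hOo.mem_nhds hxO)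
    have hpre : IsPreconnected (W₀ ∪ O) :=
      isPreconnected_connectedComponentIn.union z hzW₀ hzO hOc.isPreconnected
    have hsub : W₀ ∪ O ⊆ W₀ :=
      hpre.subset_connectedComponentIn (Or.inl (mem_connectedComponentIn hyW)) (union_subset hW₀W hOW)
    exact hsub (Or.inr hxO)
  set U : Opens 𝓢.carrier := ⟨W₀, hW₀o⟩ with hU
  have hUconn : IsConnected (U : Set 𝓢.carrier) := hW₀conn
  -- `J⁺(f y) ⊆ W₀`
  have hJy : g.causalFuture τ {f y} ⊆ W₀ := by
    intro x hx
    rcases hx with hx | ⟨p, hp, γ, a, b, hab, hγ, hγa, hγb⟩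
    · rw [mem_singleton_iff] at hx
      rw [hx]
      exact hyW₀
    · rw [mem_singleton_iff] at hp
      subst p
      have himgW : γ '' Icc a b ⊆ W := by
        rintro _ ⟨t, ht, rfl⟩
        refine hJW (LorentzianMetric.causalFuture_mono (singleton_subset_iff.mpr ?_)
          (hγ.apply_mem_causalFuture_apply_left ht))
        rw [hγa]
        exact hyS
      have hconn : IsPreconnected (γ '' Icc a b) :=
        isPreconnected_Icc.image γ fun t ht ↦ (hγ t ht).1.continuousAt.continuousWithinAt
      have hsub : γ '' Icc a b ⊆ W₀ :=
        hconn.subset_connectedComponentIn ⟨a, ⟨le_rfl, hab.le⟩, hγa⟩ himgW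
      rw [← hγb]
      exact hsub ⟨b, ⟨hab.le, le_rfl⟩, rfl⟩
  have hqW₀ : q ∈ W₀ := hJy hq
  -- (4) the sub-spacetime `𝓢'`
  set 𝓢' : Spacetime.{0} 4 := 𝓢.restrict hres hτr U hUconn with h𝓢'
  haveI i₁ : 𝓢'.metric.HasLeviCivita := 𝓢'.metric.toPseudoRiemannianMetric.hasLeviCivita
  haveI i₂ : (g.restrict hres U).HasLeviCivita := i₁
  haveI i₃ : CovariantDerivative.ContMDiffCovariantDerivative 𝓢'.metric.leviCivita 1 :=
    ⟨𝓢'.metric.isLocallyContMDiff_leviCivita_holds 1 (by exact_mod_cast le_top) univ isOpen_univ⟩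
  have hCauchy : 𝓢'.metric.IsCauchyHypersurface 𝓢'.timeOrientation (Subtype.val ⁻¹' S) :=
    isCauchyHypersurface_domain hres hτr hT hW hE hE' hFC hn2 hA U hW₀W hW₀cl
  have hGH : 𝓢'.metric.IsGloballyHyperbolic 𝓢'.timeOrientation :=
    hCauchy.isGloballyHyperbolic le_rfl
  have htc' : 𝓢'.metric.SatisfiesTimelikeConvergence :=
    satisfiesTimelikeConvergence_restrict 𝓢 U htc
  -- (5) the piece of the hypersurface inside `W₀`
  set N₀ : Opens N := ⟨f ⁻¹' W₀, hW₀o.preimage hf.contMDiff.continuous⟩ with hN₀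
  have hf₁ : g.IsSpacelikeImmersion (𝓡 3) (f ∘ Subtype.val : N₀ → 𝓢.carrier) := hf.comp_subtypeVal
  have hf₁U : ∀ z : N₀, (f ∘ Subtype.val : N₀ → 𝓢.carrier) z ∈ U := fun z ↦ z.2
  have hpb₁ : PseudoRiemannianMetric.contMDiff_pullbackBilin (𝓡 4) 𝓢.carrier (𝓡 3) N₀ ∞ :=
    PseudoRiemannianMetric.contMDiff_pullbackBilin_holds
  have hpb₀ : PseudoRiemannianMetric.contMDiff_pullbackBilin (𝓡 4) U (𝓡 3) N₀ ∞ :=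
    PseudoRiemannianMetric.contMDiff_pullbackBilin_holds
  have hf₀ : 𝓢'.metric.IsSpacelikeImmersion (𝓡 3)
      (fun z : N₀ ↦ (⟨(f ∘ Subtype.val : N₀ → 𝓢.carrier) z, hf₁U z⟩ : U)) :=
    isSpacelikeImmersion_codRestrict 𝓢 U hf₁U hf₁
  have hν₁ : ContMDiff (𝓡 3) (𝓡 4).tangent ∞ (fun z : N₀ ↦
      (TotalSpace.mk' E4 ((f ∘ Subtype.val : N₀ → 𝓢.carrier) z) (ν z.1) :
        TangentBundle (𝓡 4) 𝓢.carrier)) :=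
    hν.comp contMDiff_subtype_val
  have hν₀ : ContMDiff (𝓡 3) (𝓡 4).tangent ∞ (fun z : N₀ ↦
      (TotalSpace.mk' E4 (⟨(f ∘ Subtype.val : N₀ → 𝓢.carrier) z, hf₁U z⟩ : U) (ν z.1) :
        TangentBundle (𝓡 4) U)) :=
    contMDiff_normal_codRestrict 𝓢 U hf₁U hν₁
  have hfun₁ : g.IsFutureUnitNormal (𝓡 3) τ (f ∘ Subtype.val : N₀ → 𝓢.carrier) (fun z ↦ ν z.1) :=
    ⟨hfun.1.comp_subtypeVal fun z ↦ (hf.contMDiff z).mdifferentiableAt (by simp), fun z ↦ hfun.2 z.1⟩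
  have hfun₀ : 𝓢'.metric.IsFutureUnitNormal (𝓡 3) 𝓢'.timeOrientation
      (fun z : N₀ ↦ (⟨(f ∘ Subtype.val : N₀ → 𝓢.carrier) z, hf₁U z⟩ : U)) (fun z ↦ ν z.1) :=
    isFutureUnitNormal_codRestrict 𝓢 U hf₁U hf₁ hfun₁
  have hrange : Set.range (fun z : N₀ ↦ (⟨(f ∘ Subtype.val : N₀ → 𝓢.carrier) z, hf₁U z⟩ : U)) =
      Subtype.val ⁻¹' S := by
    ext x
    constructor
    · rintro ⟨z, rfl⟩
      exact ⟨z.1, rfl⟩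
    · rintro ⟨z, hz⟩
      have hzN : z ∈ N₀ := show f z ∈ W₀ by rw [hz]; exact x.2
      exact ⟨⟨z, hzN⟩, Subtype.ext hz⟩
  have hS₀ : 𝓢'.metric.IsCauchyHypersurface 𝓢'.timeOrientation
      (Set.range (fun z : N₀ ↦ (⟨(f ∘ Subtype.val : N₀ → 𝓢.carrier) z, hf₁U z⟩ : U))) := by
    rw [Set.ext_iff] at hrange
    intro γ s hγ
    obtain ⟨t, ht, huniq⟩ := hCauchy γ s hγ
    exact ⟨t, ⟨ht.1, (hrange _).mpr ht.2⟩, fun t' ht' ↦ huniq t' ⟨ht'.1, (hrange _).mp ht'.2⟩⟩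
  have hH₀ : ∀ z : N₀, 𝓢'.metric.meanCurvature
      (fun z : N₀ ↦ (⟨(f ∘ Subtype.val : N₀ → 𝓢.carrier) z, hf₁U z⟩ : U)) hpb₀ hf₀ (fun z ↦ ν z.1) z
        ≤ -C := by
    intro z
    have h1 := meanCurvature_codRestrict 𝓢 U hf₁U hf₁ hpb₁ hpb₀ (ν := fun z ↦ ν z.1) (z := z)
      ((hν₁ z).mdifferentiableAt (by simp))
    have h2 := PseudoRiemannianMetric.meanCurvature_comp_subtypeVal hpb hpb₁ hf ν z
    calc 𝓢'.metric.meanCurvature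
          (fun z : N₀ ↦ (⟨(f ∘ Subtype.val : N₀ → 𝓢.carrier) z, hf₁U z⟩ : U)) hpb₀ hf₀
          (fun z ↦ ν z.1) z
        = g.meanCurvature (f ∘ Subtype.val : N₀ → 𝓢.carrier) hpb₁ hf₁ (fun z ↦ ν z.1) z := h1
      _ = g.meanCurvature f hpb hf ν z.1 := h2
      _ ≤ -C := hHle z.1
  -- (6) Hawking's bound in `𝓢'`
  have hbound := hH 𝓢' hGH htc' N₀
    (fun z : N₀ ↦ (⟨(f ∘ Subtype.val : N₀ → 𝓢.carrier) z, hf₁U z⟩ : U)) hpb₀ hf₀ (fun z ↦ ν z.1)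
    hν₀ hfun₀ hS₀ C hC hH₀ ⟨y, hyW₀⟩ ⟨q, hqW₀⟩
  -- (7) comparison of the separations
  have hstay : ∀ (γ : ℝ → 𝓢.carrier) (a b : ℝ), a < b → g.IsFutureCausalCurveOn τ γ (Icc a b) →
      γ a = f y → γ b = q → ∀ t ∈ Icc a b, γ t ∈ U := by
    intro γ a b hab hγ hγa hγb t ht
    refine hJy (LorentzianMetric.causalFuture_mono (singleton_subset_iff.mpr ?_)
      (hγ.apply_mem_causalFuture_apply_left ht))
    rw [hγa]
    exact mem_singleton _
  calc 𝓢.lorentzDist (f y) q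
      = g.lorentzDist τ (f y) q := rfl
    _ ≤ (g.restrict hres U).lorentzDist (τ.restrict hres hτr U) ⟨f y, hyW₀⟩ ⟨q, hqW₀⟩ :=
        lorentzDist_le_lorentzDist_restrict hres hτr hyW₀ hqW₀ hstay
    _ = 𝓢'.lorentzDist ⟨f y, hyW₀⟩ ⟨q, hqW₀⟩ := rfl
    _ ≤ ENNReal.ofReal (3 / C) := hbound

end Summit.FinalStateConjecture.FinalStateConjecture.Theorems.PhotonSphereChannels.TameCensorshipCrush

end
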